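import Literature.Geometry.Lorentzian.CarterThresholdRegimeKernel
import Literature.Geometry.Lorentzian.CarterThresholdKernelBookkeeping
import HarnessLib

/-!
# The threshold-regime cone kernel bound for Carter's equation, Λ-polynomial constants (u-language)
(namespace `Literature.Geometry.Lorentzian.Kerr`.)

The analytic core of the THRESHOLD case `ω = mω₊` of the large-`Λ`, Breitenlohner–Freedman stable cone
kernel bound of the near-extremal Kerr programme (crux `KappaExplicitWaveDecay`, line
`olver-dunster-uniform-reduction`, stub T2sA), in Carter's tortoise variable and with Λ-POLYNOMIAL
constants: GIVEN the census of the full potential (as a hypothesis: `{r > r₊ : ω² ≤ V r}`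
order-connected in the cone), for every `M > 0`, collar `θ > 0` and margin `θ₁ > 0` there are `Λ₀`,
`a₁ < M`, `ε₀ > 0`, `C > 0`, `N` such that for `a₁ ≤ |a| < M`, admissible `(ω, m, Λ)` with `0 < m`,
`Λ₀ < Λ`, `(1 + θ₁)(2r₊ω)² ≤ Λ − 2amω`, `|ω − mω₊| ≤ ε₀m` and `ω − mω₊ = 0`, every tortoise radius,
every pair `u_𝓗, u_𝓘` with horizon data (`‖u_𝓗‖ → 1`, `‖u_𝓗′‖ → 0`, flux `0`) and infinity data
(`‖u_𝓘‖ → 1`, `‖u_𝓘′‖ → |ω|`, flux `ω`), and all `x ≤ x′` with `ρ x′ ≥ r₊ + θ(r₊ − r₋)`: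

  `‖u_𝓗 x‖·‖u_𝓘 x′‖ ≤ C·Λ^N·κ^{−N}·‖u_𝓗 u_𝓘′ − u_𝓘 u_𝓗′‖(x)`   (`thresholdRegime_corePoly`).

Proof = `thresholdRegime_kernel_le` (uniform explicit constant) + bookkeeping: `a₁` from
`nearExtremal_of_abs_ge`, `ε₀ = 1/(16M)`, the depth condition from `exists_forall_mul_pow_le_sinh`
through the κ-free master variable (`freeMaster_bounds`), `Λ′ ≥ Λ/256` (`lambdaPrime_ge_of_margin`),
and `K ≤ c_K Y^116` (`thresholdKernelConstant_le_pow`, `layerMaster_bounds`), `N = 116`.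

## References
* M. Dafermos, I. Rodnianski, Y. Shlapentokh-Rothman, arXiv:1402.7034 = Ann. of Math. 183 (2016),
  §§5.2.3, 6, 8 (key `DafermosRodnianskiShlapentokhrothman2014`).
* R. Teixeira da Costa, Commun. Math. Phys. 378 (2020), Prop. 2.20 (key `Costa2019`). Folklore assembly.
-/

noncomputable section

open Filter Set
open scoped _root_.Topology _root_.ComplexConjugate

namespace Literature.Geometry.Lorentzian

namespace Kerr

section CorePoly

variable {M a ω Λ : ℝ} {m : ℤ}

/-- The absolute constants of the bookkeeping are positive. [folklore] -/
private theorem consts_pos :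
    (0 : ℝ) < 8 * 678 * (7e4) ^ 16 ∧ (0 : ℝ) < 676 + 1e4 * (8 * 678 * (7e4) ^ 16) ∧
    (0 : ℝ) < 2 + 8 * 678 * (7e4) ^ 16 := by
  refine ⟨by positivity, by positivity, by positivity⟩

/-- **The uniform depth condition from `Λ` large (κ-free).** In the cone (`M/2 ≤ |a| ≤ M`, admissible
`(ω, m, Λ)`, `0 < m`, `|ω − mω₊| ≤ ε₀m`, `ε₀ ≤ 1/(16M)`), with `Λ/256 ≤ Λ′`, `0 < θ₁ ≤ 1`, and `Λ`
beyond the threshold `Λ_d` of `exists_forall_mul_pow_le_sinh` for `c = (θ₁/3)⁴/2048`,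
`C = 864·c_L·A_Z^124` (`A_Z = 32(1 + M + M⁻¹)⁴(1 + θ₁⁻¹)`, `c_L = 128(16c_P + c_P′)`), the depth
condition of `thresholdRegime_kernel_le` holds. [folklore] -/
theorem thresholdDepth_of_large (hM : 0 < M) (haM : |a| ≤ M) (ha : M / 2 ≤ |a|)
    (hadm : IsAdmissibleTriple a ω m Λ) (hm : 0 < m) {ε₀ θ₁ Λ' : ℝ} (hε₀ : ε₀ ≤ 1 / (16 * M))
    (hcone : |ω - m * horizonAngularVelocity M a| ≤ ε₀ * |(m : ℝ)|) (hθ₁ : 0 < θ₁) (hθ₁1 : θ₁ ≤ 1)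
    (hΛ' : Λ / 256 ≤ Λ')
    (hsinh : 864 * (128 * (16 * (676 + 1e4 * (8 * 678 * (7e4) ^ 16)) + (2 + 8 * 678 * (7e4) ^ 16))) *
        (32 * (1 + M + M⁻¹) ^ 4 * (1 + θ₁⁻¹)) ^ 124 * Λ ^ 124 ≤
      Real.sinh ((θ₁ / 3) ^ 4 / 2048 * Real.sqrt Λ))
    {R B PI PI' : ℝ} (hRdef : R = max (7 * M) (max (Real.sqrt (12 * Λ) / |ω|) (1 / (M * ω ^ 2))))
    (hBdef : B = ((ω ^ 2 + 6 * Λ / M ^ 2) / (θ₁ / (100 * M)) ^ 2) ^ 16 *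
      Real.exp (2 * (θ₁ / (100 * M)) * (50 * M ^ 2 / (θ₁ * M / 2))) *
      ((θ₁ / (100 * M)) ^ 2 * (2 + 2 * |ω| * R) ^ 2 + 2 * ω ^ 2))
    (hPIdef : PI = Real.sqrt ((2 + 2 * |ω| * R) ^ 2 + B / (θ₁ / (100 * M)) ^ 2))
    (hPI'def : PI' = Real.sqrt (2 * ω ^ 2 + B)) :
    8 * ((PI * (ω ^ 2 * R / 3) + PI') * Real.exp 1) ^ 2 ≤
      ω ^ 2 * (θ₁ / 3) ^ 3 / 32 * Real.sinh (2 * ((θ₁ / 3) ^ 4 * Real.sqrt Λ' / 256)) := by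
  obtain ⟨hcB, hcP, hcP'⟩ := consts_pos
  set cB : ℝ := 8 * 678 * (7e4) ^ 16 with hcBdef
  set cP : ℝ := 676 + 1e4 * cB with hcPdef
  set cP' : ℝ := 2 + cB with hcP'def
  set cL : ℝ := 128 * (16 * cP + cP') with hcL
  have hcL0 : 0 < cL := by rw [hcL]; positivity
  -- the κ-free master variable
  obtain ⟨hZ1, hωZ, hωiZ, hΛZ, hMZ, hMiZ, hM2iZ, hθ₁Z⟩ := freeMaster_bounds hM haM ha hadm hm hε₀ hcone hθ₁
  set Z := 32 * (1 + M + M⁻¹) ^ 4 * (1 + θ₁⁻¹) * Λ with hZdef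
  have hZ124 : Z ^ 124 = (32 * (1 + M + M⁻¹) ^ 4 * (1 + θ₁⁻¹)) ^ 124 * Λ ^ 124 := by
    rw [hZdef, mul_pow]
  rw [mul_assoc (864 * cL), ← hZ124] at hsinh
  clear hZ124
  clear_value cB cP cP' cL Z
  have hZ0 : 0 < Z := by linarith only [hZ1]
  have hm1 : (1 : ℝ) ≤ m := by exact_mod_cast hm
  have hΛ1 : 1 ≤ Λ := by nlinarith only [hadm.sq_le, hm1]
  have hω0 : 0 < |ω| := by
    have := (cone_abs_omega_le_div hM haM ha hadm hm hε₀ hcone).1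
    exact lt_of_lt_of_le (by positivity) this
  -- atoms
  have hR0 : 0 ≤ R := by rw [hRdef]; exact le_trans (by positivity) (le_max_left _ _)
  have hR : R ≤ 12 * Z ^ 3 := by rw [hRdef]; exact farRadius_le_pow hZ1 hΛ1 hΛZ hMZ hMiZ hω0 hωiZ
  have hB : B ≤ cB * Z ^ 105 := by
    rw [hBdef, hcBdef]
    exact farConstant_B_le_pow hZ1 hM hθ₁ hθ₁1 hωZ hΛZ (by linarith only [hΛ1]) hM2iZ hθ₁Z hMZ hR0 hR
  have hB' : B ≤ 8 * 678 * (7e4) ^ 16 * Z ^ 105 := by rw [← hcBdef]; exact hB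
  obtain ⟨hPI2, hPI'2⟩ := farEnvelope_sq_le_pow hZ1 hM hθ₁ hθ₁1 hωZ hM2iZ hθ₁Z hMZ hR0 hR hB'
  rw [← hcBdef] at hPI2 hPI'2
  rw [← hcPdef] at hPI2
  rw [← hcP'def] at hPI'2
  have hB0 : 0 ≤ B := by rw [hBdef]; positivity
  have hE0 : 0 ≤ (2 + 2 * |ω| * R) ^ 2 + B / (θ₁ / (100 * M)) ^ 2 := by positivity
  have hE'0 : 0 ≤ 2 * ω ^ 2 + B := by positivity
  have hPIsq : PI ^ 2 ≤ cP * Z ^ 109 := by rw [hPIdef, Real.sq_sqrt hE0]; exact hPI2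
  have hPI'sq : PI' ^ 2 ≤ cP' * Z ^ 105 := by rw [hPI'def, Real.sq_sqrt hE'0]; exact hPI'2
  have hPI0 : 0 ≤ PI := by rw [hPIdef]; exact Real.sqrt_nonneg _
  have hPI'0 : 0 ≤ PI' := by rw [hPI'def]; exact Real.sqrt_nonneg _
  -- the left side `≤ c_L Z^119`
  have hω2 : ω ^ 2 ≤ Z ^ 2 := by rw [← sq_abs]; exact pow_le_pow_left₀ (abs_nonneg _) hωZ 2
  have hl : 8 * ((PI * (ω ^ 2 * R / 3) + PI') * Real.exp 1) ^ 2 ≤ cL * Z ^ 119 := by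
    have hq : (ω ^ 2 * R / 3) ^ 2 ≤ 16 * Z ^ 10 := by
      have h1 : ω ^ 2 * R / 3 ≤ Z ^ 2 * (12 * Z ^ 3) / 3 := by
        gcongr
      have h0 : 0 ≤ ω ^ 2 * R / 3 := by positivity
      calc (ω ^ 2 * R / 3) ^ 2 ≤ (Z ^ 2 * (12 * Z ^ 3) / 3) ^ 2 := pow_le_pow_left₀ h0 h1 2
        _ = 16 * Z ^ 10 := by ring
    have e1 : (PI * (ω ^ 2 * R / 3) + PI') ^ 2 ≤ 2 * (PI ^ 2 * (ω ^ 2 * R / 3) ^ 2) + 2 * PI' ^ 2 := by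
      nlinarith only [sq_nonneg (PI * (ω ^ 2 * R / 3) - PI')]
    have e2 : PI ^ 2 * (ω ^ 2 * R / 3) ^ 2 ≤ cP * Z ^ 109 * (16 * Z ^ 10) :=
      mul_le_mul hPIsq hq (sq_nonneg _) (by positivity)
    have e3 : Z ^ 105 ≤ Z ^ 119 := pow_le_pow_right₀ hZ1 (by norm_num)
    have e3' : cP' * Z ^ 105 ≤ cP' * Z ^ 119 := mul_le_mul_of_nonneg_left e3 hcP'.le
    have hexp : Real.exp 1 ^ 2 ≤ 8 := by
      have h := Real.exp_one_lt_d9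
      nlinarith only [Real.exp_pos 1, h]
    have e6 : (PI * (ω ^ 2 * R / 3) + PI') ^ 2 ≤ 2 * (cP * Z ^ 109 * (16 * Z ^ 10)) + 2 * (cP' * Z ^ 119) := by
      linarith only [e1, e2, hPI'sq, e3']
    have e4 : ((PI * (ω ^ 2 * R / 3) + PI') * Real.exp 1) ^ 2 ≤
        (2 * (cP * Z ^ 109 * (16 * Z ^ 10)) + 2 * (cP' * Z ^ 119)) * 8 := by
      rw [mul_pow]
      exact mul_le_mul e6 hexp (by positivity) (by positivity)
    have e5 : (2 * (cP * Z ^ 109 * (16 * Z ^ 10)) + 2 * (cP' * Z ^ 119)) * 8 * 8 = cL * Z ^ 119 := by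
      rw [hcL]; ring
    linarith only [e4, e5]
  -- the right side `≥ Z⁻⁵/864 · sinh(c√Λ) ≥ c_L Z^119`
  have hΛ0 : 0 ≤ Λ := by linarith only [hΛ1]
  have harg : (θ₁ / 3) ^ 4 / 2048 * Real.sqrt Λ ≤ 2 * ((θ₁ / 3) ^ 4 * Real.sqrt Λ' / 256) := by
    have h1 : Real.sqrt Λ / 16 ≤ Real.sqrt Λ' := by
      rw [div_le_iff₀ (by norm_num)]
      calc Real.sqrt Λ = Real.sqrt (Λ / 256 * 16 ^ 2) := by congr 1; ring
        _ = Real.sqrt (Λ / 256) * 16 := by rw [Real.sqrt_mul (by positivity), Real.sqrt_sq (by norm_num)]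
        _ ≤ Real.sqrt Λ' * 16 := by gcongr
    have h0 : 0 ≤ (θ₁ / 3) ^ 4 := by positivity
    have := mul_le_mul_of_nonneg_left h1 h0
    have e : (θ₁ / 3) ^ 4 / 2048 * Real.sqrt Λ = (θ₁ / 3) ^ 4 * (Real.sqrt Λ / 16) / 128 := by ring
    rw [e]; linarith only [this]
  have hsinh_mono := Real.sinh_le_sinh.2 harg
  have hsinh0 : 0 ≤ Real.sinh ((θ₁ / 3) ^ 4 / 2048 * Real.sqrt Λ) := Real.sinh_nonneg_iff.2 (by positivity)
  -- `ω² (θ₁/3)³/32 ≥ Z⁻⁵/864`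
  have hωlow : Z⁻¹ ≤ |ω| := by rw [inv_le_comm₀ hZ0 hω0]; exact hωiZ
  have hθlow : Z⁻¹ ≤ θ₁ := by rw [inv_le_comm₀ hZ0 hθ₁]; exact hθ₁Z
  have hcoef : (Z ^ 5)⁻¹ / 864 ≤ ω ^ 2 * (θ₁ / 3) ^ 3 / 32 := by
    have h1 : (Z⁻¹) ^ 2 ≤ ω ^ 2 := by
      rw [← sq_abs ω]; exact pow_le_pow_left₀ (by positivity) hωlow 2
    have h2 : (Z⁻¹ / 3) ^ 3 ≤ (θ₁ / 3) ^ 3 := pow_le_pow_left₀ (by positivity) (by linarith only [hθlow]) 3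
    calc (Z ^ 5)⁻¹ / 864 = (Z⁻¹) ^ 2 * (Z⁻¹ / 3) ^ 3 / 32 := by rw [← inv_pow]; ring
      _ ≤ ω ^ 2 * (θ₁ / 3) ^ 3 / 32 := by gcongr
  -- combine: `c_L Z^119 ≤ Z⁻⁵/864 · sinh(c√Λ)`
  have hfin : cL * Z ^ 119 ≤ (Z ^ 5)⁻¹ / 864 * Real.sinh ((θ₁ / 3) ^ 4 / 2048 * Real.sqrt Λ) := by
    have hZ5 : 0 < Z ^ 5 := pow_pos hZ0 5
    rw [div_mul_eq_mul_div, le_div_iff₀ (by norm_num)]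
    -- `cL Z^119 · 864 ≤ (Z^5)⁻¹ · sinh` iff `cL Z^119 · 864 · Z^5 ≤ sinh`
    rw [← sub_nonneg]
    have e : (Z ^ 5)⁻¹ * Real.sinh ((θ₁ / 3) ^ 4 / 2048 * Real.sqrt Λ) - cL * Z ^ 119 * 864 =
        (Z ^ 5)⁻¹ * (Real.sinh ((θ₁ / 3) ^ 4 / 2048 * Real.sqrt Λ) - 864 * cL * Z ^ 124) := by
      field_simp
    rw [e]
    exact mul_nonneg (inv_nonneg.2 hZ5.le) (sub_nonneg.2 hsinh)
  calc 8 * ((PI * (ω ^ 2 * R / 3) + PI') * Real.exp 1) ^ 2 ≤ cL * Z ^ 119 := hl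
    _ ≤ (Z ^ 5)⁻¹ / 864 * Real.sinh ((θ₁ / 3) ^ 4 / 2048 * Real.sqrt Λ) := hfin
    _ ≤ ω ^ 2 * (θ₁ / 3) ^ 3 / 32 * Real.sinh (2 * ((θ₁ / 3) ^ 4 * Real.sqrt Λ' / 256)) :=
        mul_le_mul hcoef hsinh_mono hsinh0 (by positivity)

/-! ### The threshold core with Λ-polynomial constants -/

set_option maxHeartbeats 400000 in
-- assembly of the explicit-constant theorem with the bookkeeping; large literal constants
/-- **The threshold-regime cone kernel bound, Λ-polynomial constants (u-language).** See the module
docstring. GIVEN the census (first hypothesis), for `M > 0`, `θ > 0`, `θ₁ > 0` there are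
`Λ₀, a₁ < M, ε₀ > 0, C > 0, N` such that the two-point bound
`‖u_𝓗 x‖‖u_𝓘 x′‖ ≤ CΛ^Nκ^{-N}‖u_𝓗 u_𝓘′ − u_𝓘 u_𝓗′‖(x)` holds at the threshold `ω − mω₊ = 0` for
admissible `(ω, m, Λ)` with `0 < m`, `Λ₀ < Λ`, `(1 + θ₁)(2r₊ω)² ≤ Λ − 2amω`, `|ω − mω₊| ≤ ε₀m`,
every tortoise radius, every pair with horizon/infinity data, and all `x ≤ x′` with
`ρ x′ ≥ r₊ + θ(r₊ − r₋)`. [folklore] -/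
theorem thresholdRegime_corePoly
    (hcensus : ∀ M : ℝ, 0 < M → ∃ a₁ ε₀ : ℝ, a₁ < M ∧ 0 < ε₀ ∧
      ∀ a : ℝ, a₁ ≤ |a| → IsSubextremal M a →
        ∀ (ω : ℝ) (m : ℤ) (Λ : ℝ), IsAdmissibleTriple a ω m Λ → m ≠ 0 →
          |ω - m * horizonAngularVelocity M a| ≤ ε₀ * |(m : ℝ)| →
            (Ioi (rPlus M a) ∩ {r : ℝ | ω ^ 2 ≤ sepPotential M a ω m Λ r}).OrdConnected)
    {M : ℝ} (hM : 0 < M) {θ : ℝ} (hθ : 0 < θ) {θ₁ : ℝ} (hθ₁ : 0 < θ₁) :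
    ∃ (Λ₀ a₁ ε₀ C : ℝ) (N : ℕ), a₁ < M ∧ 0 < ε₀ ∧ 0 < C ∧
      ∀ a : ℝ, a₁ ≤ |a| → IsSubextremal M a →
        ∀ (ω : ℝ) (m : ℤ) (Λ : ℝ), IsAdmissibleTriple a ω m Λ → 0 < m → Λ₀ < Λ →
          (1 + θ₁) * (2 * rPlus M a * ω) ^ 2 ≤ Λ - 2 * a * m * ω →
          |ω - m * horizonAngularVelocity M a| ≤ ε₀ * |(m : ℝ)| →
          ω - m * horizonAngularVelocity M a = 0 →
            ∀ ρ : ℝ → ℝ, IsTortoiseRadius M a ρ →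
            ∀ uH uH₁ uI uI₁ : ℝ → ℂ,
              (∀ x, HasDerivAt uH (uH₁ x) x ∧
                HasDerivAt uH₁ (-(((ω ^ 2 - sepPotential M a ω m Λ (ρ x) : ℝ) : ℂ) * uH x)) x) →
              (∀ x, HasDerivAt uI (uI₁ x) x ∧
                HasDerivAt uI₁ (-(((ω ^ 2 - sepPotential M a ω m Λ (ρ x) : ℝ) : ℂ) * uI x)) x) →
              Tendsto (fun x ↦ ‖uH x‖) atBot (𝓝 1) →
              Tendsto (fun x ↦ ‖uH₁ x‖) atBot (𝓝 |ω - m * horizonAngularVelocity M a|) →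
              (∀ x, (starRingEnd ℂ (uH x) * uH₁ x).im = -(ω - m * horizonAngularVelocity M a)) →
              Tendsto (fun x ↦ ‖uI x‖) atTop (𝓝 1) →
              Tendsto (fun x ↦ ‖uI₁ x‖) atTop (𝓝 |ω|) →
              (∀ x, (starRingEnd ℂ (uI x) * uI₁ x).im = ω) →
                ∀ x x' : ℝ, x ≤ x' → rPlus M a + θ * (rPlus M a - rMinus M a) ≤ ρ x' →
                  ‖uH x‖ * ‖uI x'‖ ≤
                    C * Λ ^ N * (surfaceGravity M a)⁻¹ ^ N * ‖uH x * uI₁ x - uI x * uH₁ x‖ := by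
  obtain ⟨hcB, hcP, hcP'⟩ := consts_pos
  -- the margin may be taken `≤ 1`
  set θ₁' := min θ₁ 1 with hθ₁'def
  have hθ₁' : 0 < θ₁' := lt_min hθ₁ one_pos
  have hθ₁'1 : θ₁' ≤ 1 := min_le_right _ _
  have hθ₁'le : θ₁' ≤ θ₁ := min_le_left _ _
  -- census constants and near-extremality
  obtain ⟨a₁, ε₀, ha₁, hε₀, hcen⟩ := hcensus M hM
  obtain ⟨ha₁half, ha₁lt, hnear⟩ := nearExtremal_of_abs_ge hM hθ hθ₁' hθ₁'1
  set a₁' := M * (1 - θ₁' ^ 2 / (128 * (1 + θ) ^ 2)) with ha₁'def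
  -- the depth threshold
  set cL : ℝ := 128 * (16 * (676 + 1e4 * (8 * 678 * (7e4) ^ 16)) + (2 + 8 * 678 * (7e4) ^ 16)) with hcL
  have hcL0 : 0 < cL := by rw [hcL]; positivity
  have hMi : 0 < M⁻¹ := inv_pos.2 hM
  set AZ : ℝ := 32 * (1 + M + M⁻¹) ^ 4 * (1 + θ₁'⁻¹) with hAZ
  have hAZ0 : 0 < AZ := by rw [hAZ]; positivity
  obtain ⟨Λd, -, hΛd⟩ := exists_forall_mul_pow_le_sinh (C := 864 * cL * AZ ^ 124)
    (show 0 < (θ₁' / 3) ^ 4 / 2048 by positivity) 124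
  -- the kernel constant
  set AY : ℝ := 32 * (1 + M + M⁻¹) ^ 4 * (1 + θ⁻¹) * (1 + θ₁'⁻¹) with hAY
  have hAY0 : 0 < AY := by rw [hAY]; positivity
  set cK : ℝ := 5e5 + 8 * (2 * (676 + 1e4 * (8 * 678 * (7e4) ^ 16)) +
    2 * 829440 ^ 2 * (2 + 8 * 678 * (7e4) ^ 16)) + 7777 with hcK
  have hcK0 : 0 < cK := by rw [hcK]; positivity
  clear_value θ₁' a₁' cL AZ AY cK
  refine ⟨max (256 * (2.5e10 / θ₁' ^ 3)) Λd, max a₁ a₁', min ε₀ (1 / (16 * M)), cK * AY ^ 116, 116,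
    max_lt ha₁ ha₁lt, lt_min hε₀ (by positivity), by positivity, ?_⟩
  intro a ha hsub ω m Λ hadm hm hΛ hBF hcone hσ ρ hρ uH uH₁ uI uI₁ hu hv hH0 _ hHf hI0 hI1 hIf x x' hxx' hx'
  have haM : |a| ≤ M := le_of_lt hsub
  have ha2 : M / 2 ≤ |a| := ha₁half.trans ((le_max_right _ _).trans ha)
  have hε16 : min ε₀ (1 / (16 * M)) ≤ 1 / (16 * M) := min_le_right _ _
  have hκ : 0 < surfaceGravity M a := hsub.surfaceGravity_pos
  -- census, threshold, `ω ≠ 0`, `Λ ≥ 1`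
  have hord : (Ioi (rPlus M a) ∩ {r : ℝ | ω ^ 2 ≤ sepPotential M a ω m Λ r}).OrdConnected :=
    hcen a ((le_max_left _ _).trans ha) hsub ω m Λ hadm hm.ne'
      (hcone.trans (mul_le_mul_of_nonneg_right (min_le_left _ _) (abs_nonneg _)))
  have hωth : ω = m * horizonAngularVelocity M a := sub_eq_zero.1 hσ
  obtain ⟨-, -, hω0⟩ := cone_abs_omega_le_div hM haM ha2 hadm hm hε16 hcone
  have hm1 : (1 : ℝ) ≤ m := by exact_mod_cast hm
  have hΛ1 : 1 ≤ Λ := by nlinarith only [hadm.sq_le, hm1]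
  -- the margin with `θ₁'`, near-extremality, `Λ′` large
  have hBF' : (1 + θ₁') * (2 * rPlus M a * ω) ^ 2 ≤ Λ - 2 * a * m * ω :=
    le_trans (mul_le_mul_of_nonneg_right (by linarith only [hθ₁'le]) (sq_nonneg _)) hBF
  obtain ⟨hd, hθd⟩ := hnear a ((le_max_right _ _).trans ha) haM
  have hΛ'256 := lambdaPrime_ge_of_margin hM haM ha2 hm hε16 hcone hθ₁'.le hBF'
  have hΛ'big : 2.5e10 / θ₁' ^ 3 ≤ Λ - 2 * a * m * ω := by
    have : 256 * (2.5e10 / θ₁' ^ 3) ≤ Λ := le_trans (le_max_left _ _) hΛ.le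
    linarith only [this, hΛ'256]
  have hsinh := hΛd Λ (le_trans (le_max_right _ _) hΛ.le)
  rw [hcL, hAZ] at hsinh
  -- the depth and the explicit-constant bound
  have hdepth := thresholdDepth_of_large hM haM ha2 hadm hm hε16 hcone hθ₁' hθ₁'1 hΛ'256 hsinh
    rfl rfl rfl rfl
  have key := thresholdRegime_kernel_le hρ hsub hadm hΛ1 hωth hω0 hθ₁' hθ₁'1 hBF' hd hθ hθd hΛ'big hord
    hu hv hH0 hHf hI0 hI1 hIf rfl rfl rfl rfl rfl rfl rfl hdepth hxx' hx'
  refine key.trans (mul_le_mul_of_nonneg_right ?_ (norm_nonneg _))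
  clear key hdepth hsinh hΛd hu hv hH0 hHf hI0 hI1 hIf hxx' hx' hcen hord
  -- bookkeeping: every atom is a power of `Y`
  obtain ⟨hY1, hωY, hωiY, hΛY, hκY, hMY, hMiY, hM2Y, hθY, hθ₁Y, hdY⟩ :=
    layerMaster_bounds hsub ha2 hadm hm hε16 hcone hθ hθ₁'
  set Y := 32 * (1 + M + M⁻¹) ^ 4 * (1 + θ⁻¹) * (1 + θ₁'⁻¹) * Λ / surfaceGravity M a with hYdef
  have hYpow : Y ^ 116 = AY ^ 116 * Λ ^ 116 * (surfaceGravity M a)⁻¹ ^ 116 := by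
    rw [hYdef, hAY, div_eq_mul_inv, mul_pow, mul_pow]
  clear_value Y
  have hω0' : 0 < |ω| := abs_pos.2 hω0
  -- name the large expressions
  set R := max (7 * M) (max (Real.sqrt (12 * Λ) / |ω|) (1 / (M * ω ^ 2))) with hRdef
  set B := ((ω ^ 2 + 6 * Λ / M ^ 2) / (θ₁' / (100 * M)) ^ 2) ^ 16 *
      Real.exp (2 * (θ₁' / (100 * M)) * (50 * M ^ 2 / (θ₁' * M / 2))) *
      ((θ₁' / (100 * M)) ^ 2 * (2 + 2 * |ω| * R) ^ 2 + 2 * ω ^ 2) with hBdef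
  set PI := Real.sqrt ((2 + 2 * |ω| * R) ^ 2 + B / (θ₁' / (100 * M)) ^ 2) with hPIdef
  set PI' := Real.sqrt (2 * ω ^ 2 + B) with hPI'def
  set Δθ := delta M a (rPlus M a + θ * (rPlus M a - rMinus M a)) with hΔθdef
  set A₀ := 96 * R ^ 2 / (θ₁' * Δθ * ω ^ 2) + 12 * R ^ 2 / θ₁' ^ 2 with hA₀def
  have hR0 : 0 ≤ R := le_trans (by positivity) (le_max_left _ _)
  have hR : R ≤ 12 * Y ^ 3 := farRadius_le_pow hY1 hΛ1 hΛY hMY hMiY hω0' hωiY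
  have hB : B ≤ 8 * 678 * (7e4) ^ 16 * Y ^ 105 :=
    farConstant_B_le_pow hY1 hM hθ₁' hθ₁'1 hωY hΛY (by linarith only [hΛ1]) hM2Y hθ₁Y hMY hR0 hR
  obtain ⟨hPI2, hPI'2⟩ := farEnvelope_sq_le_pow hY1 hM hθ₁' hθ₁'1 hωY hM2Y hθ₁Y hMY hR0 hR hB
  have hB0 : 0 ≤ B := by rw [hBdef]; positivity
  have hPIsq : PI ^ 2 ≤ (676 + 1e4 * (8 * 678 * (7e4) ^ 16)) * Y ^ 109 := by
    rw [hPIdef, Real.sq_sqrt (by positivity)]; exact hPI2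
  have hPI'sq : PI' ^ 2 ≤ (2 + 8 * 678 * (7e4) ^ 16) * Y ^ 105 := by
    rw [hPI'def, Real.sq_sqrt (by positivity)]; exact hPI'2
  -- the collar constant
  have hd0 : 0 < rPlus M a - rMinus M a := sub_pos.2 hsub.rMinus_lt_rPlus
  have hΔ : θ * (rPlus M a - rMinus M a) ^ 2 ≤ Δθ := by
    rw [hΔθdef, delta_eq_mul haM]
    have e : (rPlus M a + θ * (rPlus M a - rMinus M a) - rPlus M a) *
        (rPlus M a + θ * (rPlus M a - rMinus M a) - rMinus M a) =
        θ * (rPlus M a - rMinus M a) ^ 2 + θ ^ 2 * (rPlus M a - rMinus M a) ^ 2 := by ring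
    rw [e]
    nlinarith only [sq_nonneg θ, sq_nonneg (rPlus M a - rMinus M a)]
  have hΔθ0 : 0 < Δθ := lt_of_lt_of_le (by positivity) hΔ
  have hA₀ : A₀ ≤ 15552 * Y ^ 16 := collarConstant_le_pow hY1 hθ hθ₁' hω0' hωiY hθY hθ₁Y hR0 hR hd0 hdY hΔ
  have hA₀0 : 0 ≤ A₀ := by rw [hA₀def]; positivity
  clear_value R B PI PI' Δθ A₀
  have hKle := thresholdKernelConstant_le_pow hY1 hω0' hωiY hM hMiY hθ₁' hθ₁Y hPIsq hPI'sq hA₀0 hA₀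
  rw [← hcK, hYpow] at hKle
  calc _ ≤ cK * (AY ^ 116 * Λ ^ 116 * (surfaceGravity M a)⁻¹ ^ 116) := hKle
    _ = cK * AY ^ 116 * Λ ^ 116 * (surfaceGravity M a)⁻¹ ^ 116 := by ring

end CorePoly

end Kerr

end Literature.Geometry.Lorentzian

end
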